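import Summits.CriticalPhenomena.Ising3D.Control2DUnboundedSpectrum
import Mathlib.Analysis.SpecialFunctions.Pow.Real
import Mathlib.Tactic.Linarith
import Mathlib.Tactic.Positivity
import Mathlib.Tactic.Ring
import Mathlib.Tactic.FieldSimp
import HarnessLib

/-!
# Crossing at `Δ_σ > 0` forces quasi-primaries of unbounded SPIN (the lightcone corner of the square)
(cell `pub-ising3x`, seat controls-1 gen 43 addendum; PAPER Appendix E — CONTROL-ONLY; part 3, after
`Control2DChiralEnvelope` / `Control2DUnboundedSpectrum`)

HONEST FRAMING: lottery ticket; floor = tightest certified 3D Ising CFT bounds; no exact-solution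
claim without a proof. CONTROL-ONLY (`d = 2`, global `sl(2) × sl(2)` blocks, `Δ_σ = s` an INPUT, axiom set
`A2D′`); nothing here is about `d = 3`, no certificate, functional or number of the record is touched, and no
new hypothesis or named fact enters.

WHAT THIS FILE ADDS. `Control2DUnboundedSpectrum` used the DIAGONAL corner `z = z̄ → 1` and proved that the
DIMENSIONS of the exchanged quasi-primaries are unbounded — saying nothing about spin (a tower of scalars was not
excluded). Here the LIGHTCONE corner `z → 1` at FIXED `z̄` excludes it:

* `chiralBlock_le_rpow_mul` — `k_{2h}(x₁) ≤ (x₁/x₂)^h k_{2h}(x₂)` for `0 < x₁ ≤ x₂ < 1` (termwise); hence for a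
  unitary label with spin `ℓ` and `0 < z̄₁ ≤ z̄₂ < 1`: **`globalBlock_le_rpow_mul`** —
  `g_{Δ,ℓ}(z,z̄₁) ≤ (z̄₁/z̄₂)^{(Δ-ℓ)/2} g_{Δ,ℓ}(z,z̄₂)` (both terms carry a chiral factor of weight `≥ h̄ = (Δ-ℓ)/2`
  in the variable `z̄`): heavy operators of BOUNDED spin are exponentially suppressed at smaller `z̄`, uniformly in `z`.
* **`CrossingData.fourPoint_lightcone_upper`** — `(1-z)^s G(z,1/2) ≤ G(1/2,1/2)` for `1/2 ≤ z < 1`: crossing at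
  `(z,1/2)` and monotonicity of `G` in its first variable (`fourPoint_mono`); so along the lightcone corner `G` grows
  EXACTLY like `(1-z)^{-s}` (the lower side is `fourPoint_lower`).
* **`CrossingData.exists_spin_gt`** / **`infinite_spin_above`** — a unitary solution of the typed sum rule at
  `Δ_σ = s > 0` with convergent expansion has, above EVERY `L`, infinitely many labels with `p_i ≠ 0` and spin `> L`.
  Proof: if all non-zero coefficients had spin `≤ L`, split the expansion at `z̄₁ = 1/4` into dimensions `≤ H` (at most
  `2K²Q/(1-z)^{s/2}`, the envelope with `ε = s/4`, `Q = Σ_{Δ_i ≤ H} p_i < ∞`) and `> H` (at most `(1/2)^{(H-L)/2}` times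
  `G(z,1/2) - 1 ≤ G(1/2,1/2)(1-z)^{-s}`), against `G(z,1/4) ≥ (z/3)^s (1-z)^{-s}`; with `H = L + 2N`,
  `2^N > 4·6^s·G(1/2,1/2)`, and `z = 1 - t` close to `1` this reads `q ≤ 3q/4`, `q = 6^{-s}`. Branches with the
  convergence clause discharged, `infinite_spinning` (`ℓ ≠ 0`), the record's class at `Δ_σ = 1/8`, the witnesses.

NOT claimed: any statement about TWISTS (no accumulation of `Δ - ℓ` at `2Δ_σ + 2n`, no «double-twist» family, no
anomalous dimensions, no large-spin asymptotics or density) — only the EXISTENCE of non-zero OPE coefficients at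
arbitrarily large spin; nothing without the convergence clause beyond what `Control2DUnboundedSpectrum.infinite_support`
already says (the scalars below `2Δ_σ` of a general datum are not controlled here); Virasoro; anything three-dimensional;
any new bound; no certificate / functional / number of the record touched.

References: R. Rattazzi, V. S. Rychkov, E. Tonni, A. Vichi, JHEP 12 (2008) 031, §3 (crossing and the sum rule)
[cite: RattazziEtAl2008, §3]; F. A. Dolan, H. Osborn, Nucl. Phys. B 678 (2004) 491, §3 [cite: DolanOsborn2004, §3].
Related, stronger, `d ≥ 3`, NOT used and not the source of what is proved here: the lightcone bootstrap (identity in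
the crossed channel ⇒ double-twist families at large spin) — A. L. Fitzpatrick, J. Kaplan, D. Poland, D. Simmons-Duffin,
JHEP 12 (2013) 004; Z. Komargodski, A. Zhiboedov, JHEP 11 (2013) 140. The elementary existence statement for global
`d = 2` blocks below is recorded as folklore. Tree: `hasSum_chiralBlock`, `chiralCoeff_nonneg` (`Control2DTermwise`);
`chiralBlock_nonneg` (`Control2DNonVacuity`); `globalBlock_mono`, `globalBlock_nonneg`, `OpeConvergent`, `fourPoint`,
`fourPoint_crossing`, `opeConvergent_of_lowerBound/_of_hasScalarGap/_of_location` (`Control2DFourPoint`);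
`fourPoint_mono`, `fourPoint_lower` (`Control2DFourPointBounds`); `two_mul_rpow_le_globalBlock_diag`,
`exists_globalBlock_diag_le_envelope` (`Control2DChiralEnvelope`); `record_fourPoint_crossing` (`Control2DParityConverse`).
Mathlib: `hasSum_le`, `Summable.of_nonneg_of_le`, `HasSum.add`, `pow_unbounded_of_one_lt`, `Real.rpow_le_rpow_of_exponent_ge`.
-/

namespace Summit.CriticalPhenomena.Ising3D.Control2D

open Set
open Literature.MathematicalPhysics.QuantumFieldTheory.ConformalBootstrap3D

/-! ### Suppression of heavy bounded-spin blocks at smaller `z̄` -/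

/-- `k_{2h}(x₁) ≤ (x₁/x₂)^h · k_{2h}(x₂)` for `0 < x₁ ≤ x₂ < 1`, `h ≥ 0` (termwise: `x₁^{h+m} = x₁^h x₁^m ≤ x₁^h x₂^m`).
[folklore] -/
theorem chiralBlock_le_rpow_mul {h x₁ x₂ : ℝ} (hh : 0 ≤ h) (hx₁ : 0 < x₁) (h12 : x₁ ≤ x₂) (hx₂ : x₂ < 1) :
    chiralBlock h x₁ ≤ (x₁ / x₂) ^ h * chiralBlock h x₂ := by
  have hx₂0 : 0 < x₂ := lt_of_lt_of_le hx₁ h12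
  have S1 := hasSum_chiralBlock h hx₁ (lt_of_le_of_lt h12 hx₂)
  have S2 := (hasSum_chiralBlock h hx₂0 hx₂).mul_left ((x₁ / x₂) ^ h)
  refine hasSum_le (fun m => ?_) S1 S2
  have hθ : (x₁ / x₂) ^ h * x₂ ^ h = x₁ ^ h := by
    rw [← Real.mul_rpow (div_pos hx₁ hx₂0).le hx₂0.le, div_mul_cancel₀ _ hx₂0.ne']
  have hm1 : x₁ ^ (m : ℝ) ≤ x₂ ^ (m : ℝ) := Real.rpow_le_rpow hx₁.le h12 (Nat.cast_nonneg m)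
  rw [Real.rpow_add hx₁, Real.rpow_add hx₂0]
  calc chiralCoeff h m * (x₁ ^ h * x₁ ^ (m : ℝ))
      ≤ chiralCoeff h m * (x₁ ^ h * x₂ ^ (m : ℝ)) :=
        mul_le_mul_of_nonneg_left (mul_le_mul_of_nonneg_left hm1 (Real.rpow_nonneg hx₁.le h))
          (chiralCoeff_nonneg hh m)
    _ = (x₁ / x₂) ^ h * (chiralCoeff h m * (x₂ ^ h * x₂ ^ (m : ℝ))) := by rw [← hθ]; ring

/-- **Heavy blocks of bounded spin are suppressed at smaller `z̄`, uniformly in `z`**: for a unitary label `ℓ ≤ Δ` and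
`0 < z̄₁ ≤ z̄₂ < 1`, `g_{Δ,ℓ}(z,z̄₁) ≤ (z̄₁/z̄₂)^{(Δ-ℓ)/2} g_{Δ,ℓ}(z,z̄₂)` on `0 < z < 1` (each of the two terms of the block
carries in the variable `z̄` a chiral factor of weight `h̄ = (Δ-ℓ)/2` or `h = (Δ+ℓ)/2 ≥ h̄`). [folklore] -/
theorem globalBlock_le_rpow_mul {Δ : ℝ} {ℓ : ℕ} (hΔ : (ℓ : ℝ) ≤ Δ) {z zb₁ zb₂ : ℝ} (hz : z ∈ Ioo (0 : ℝ) 1)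
    (hzb₁ : 0 < zb₁) (h12 : zb₁ ≤ zb₂) (hzb₂ : zb₂ < 1) :
    globalBlock Δ ℓ z zb₁ ≤ (zb₁ / zb₂) ^ ((Δ - ℓ) / 2) * globalBlock Δ ℓ z zb₂ := by
  have hℓ : (0 : ℝ) ≤ ℓ := Nat.cast_nonneg ℓ
  have hh : 0 ≤ (Δ + ℓ) / 2 := by linarith
  have hhb : 0 ≤ (Δ - ℓ) / 2 := by linarith
  have hzb₂0 : 0 < zb₂ := lt_of_lt_of_le hzb₁ h12
  have hθ0 : 0 < zb₁ / zb₂ := div_pos hzb₁ hzb₂0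
  have hθ1 : zb₁ / zb₂ ≤ 1 := (div_le_one hzb₂0).mpr h12
  have A := chiralBlock_le_rpow_mul hhb hzb₁ h12 hzb₂
  have B := chiralBlock_le_rpow_mul hh hzb₁ h12 hzb₂
  have hθpow : (zb₁ / zb₂) ^ ((Δ + ℓ) / 2) ≤ (zb₁ / zb₂) ^ ((Δ - ℓ) / 2) :=
    Real.rpow_le_rpow_of_exponent_ge hθ0 hθ1 (by linarith)
  have B' : chiralBlock ((Δ + ℓ) / 2) zb₁ ≤ (zb₁ / zb₂) ^ ((Δ - ℓ) / 2) * chiralBlock ((Δ + ℓ) / 2) zb₂ :=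
    B.trans (mul_le_mul_of_nonneg_right hθpow (chiralBlock_nonneg hh ⟨hzb₂0, hzb₂⟩))
  have h1 := mul_le_mul_of_nonneg_left A (chiralBlock_nonneg hh hz)
  have h2 := mul_le_mul_of_nonneg_left B' (chiralBlock_nonneg hhb hz)
  unfold globalBlock
  nlinarith [h1, h2]

namespace CrossingData

variable {D : CrossingData} {s : ℝ}

/-! ### The lightcone corner: `G(z, z̄₂)` grows exactly like `(1-z)^{-s}` -/

/-- **Lightcone upper bound**: `(1-z)^s · G(z,1/2) ≤ G(1/2,1/2)` for `1/2 ≤ z < 1`, for every unitary solution with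
convergent expansion (crossing at `(z,1/2)`: `(1-z)^s G(z,1/2) = z^s G(1-z,1/2)`, and `G` is increasing in its first
variable). [cite: RattazziEtAl2008, §3] -/
theorem fourPoint_lightcone_upper (hU : D.IsUnitary) (hC : D.SatisfiesCrossing s) (hs : 0 ≤ s)
    (hconv : D.OpeConvergent) {z : ℝ} (hz2 : 1 / 2 ≤ z) (hz1 : z < 1) :
    (1 - z) ^ s * D.fourPoint z (1 / 2) ≤ D.fourPoint (1 / 2) (1 / 2) := by
  have hz : z ∈ Ioo (0 : ℝ) 1 := ⟨by linarith, hz1⟩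
  have hhalf : (1 / 2 : ℝ) ∈ Ioo (0 : ℝ) 1 := ⟨by norm_num, by norm_num⟩
  have hX := fourPoint_crossing hC hconv hz hhalf
  rw [show (1 : ℝ) - 1 / 2 = 1 / 2 by norm_num] at hX
  rw [Real.mul_rpow (by linarith : (0 : ℝ) ≤ 1 - z) (by norm_num : (0 : ℝ) ≤ 1 / 2),
    Real.mul_rpow (by linarith : (0 : ℝ) ≤ z) (by norm_num : (0 : ℝ) ≤ 1 / 2)] at hX
  have hh0 : 0 < (1 / 2 : ℝ) ^ s := Real.rpow_pos_of_pos (by norm_num) s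
  -- cancel `(1/2)^s`: `(1-z)^s G(z,1/2) = z^s G(1-z,1/2)`
  have hX' : (1 - z) ^ s * D.fourPoint z (1 / 2) = z ^ s * D.fourPoint (1 - z) (1 / 2) := by
    have := hX
    have e1 : (1 - z) ^ s * (1 / 2 : ℝ) ^ s * D.fourPoint z (1 / 2) =
        (1 / 2 : ℝ) ^ s * ((1 - z) ^ s * D.fourPoint z (1 / 2)) := by ring
    have e2 : z ^ s * (1 / 2 : ℝ) ^ s * D.fourPoint (1 - z) (1 / 2) =
        (1 / 2 : ℝ) ^ s * (z ^ s * D.fourPoint (1 - z) (1 / 2)) := by ring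
    rw [e1, e2] at this
    exact mul_left_cancel₀ hh0.ne' this
  have hG1 : D.fourPoint (1 - z) (1 / 2) ≤ D.fourPoint (1 / 2) (1 / 2) :=
    fourPoint_mono hU hconv (by linarith) (by norm_num) (by linarith) le_rfl (by norm_num) (by norm_num)
  have hGpos : 0 ≤ D.fourPoint (1 - z) (1 / 2) := zero_le_one.trans (one_le_fourPoint hU ⟨by linarith, by linarith⟩ hhalf)
  have hzs : z ^ s ≤ 1 := Real.rpow_le_one (by linarith) hz1.le hs
  rw [hX']
  nlinarith [mul_le_mul_of_nonneg_right hzs hGpos]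

/-- **Lightcone lower bound at `z̄ = 1/4`**: `(z/3)^s ≤ (1-z)^s G(z,1/4)` on `(0,1)` (`fourPoint_lower` at `(z,1/4)`:
`u^s ≤ v^s G`, `u = z/4`, `v = 3(1-z)/4`). [cite: RattazziEtAl2008, §3] -/
theorem fourPoint_lightcone_lower (hU : D.IsUnitary) (hC : D.SatisfiesCrossing s) (hconv : D.OpeConvergent)
    {z : ℝ} (hz : z ∈ Ioo (0 : ℝ) 1) : (z / 3) ^ s ≤ (1 - z) ^ s * D.fourPoint z (1 / 4) := by
  have hq : (1 / 4 : ℝ) ∈ Ioo (0 : ℝ) 1 := ⟨by norm_num, by norm_num⟩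
  have h := fourPoint_lower hU hC hconv hz hq
  rw [show (1 : ℝ) - 1 / 4 = 3 / 4 by norm_num] at h
  rw [Real.mul_rpow hz.1.le (by norm_num : (0 : ℝ) ≤ 1 / 4),
    Real.mul_rpow (by linarith [hz.2] : (0 : ℝ) ≤ 1 - z) (by norm_num : (0 : ℝ) ≤ 3 / 4)] at h
  have h34 : 0 < (3 / 4 : ℝ) ^ s := Real.rpow_pos_of_pos (by norm_num) s
  have hG : 0 ≤ D.fourPoint z (1 / 4) := le_trans zero_le_one (one_le_fourPoint hU hz hq)
  -- divide by `(3/4)^s`: `(1/4)^s/(3/4)^s = (1/3)^s`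
  have e : (z / 3) ^ s = z ^ s * (1 / 4 : ℝ) ^ s / (3 / 4 : ℝ) ^ s := by
    rw [mul_div_assoc, ← Real.div_rpow (by norm_num) (by norm_num), ← Real.mul_rpow hz.1.le (by norm_num)]
    congr 1; ring
  rw [e, div_le_iff₀ h34]
  calc z ^ s * (1 / 4 : ℝ) ^ s ≤ (1 - z) ^ s * (3 / 4 : ℝ) ^ s * D.fourPoint z (1 / 4) := h
    _ = (1 - z) ^ s * D.fourPoint z (1 / 4) * (3 / 4 : ℝ) ^ s := by ring

/-! ### No bounded spin -/

/-- The OPE coefficients of the labels of dimension `≤ H` are summable (convergence at `(1/2,1/2)`; each such block is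
`≥ 2(1/2)^H` there). [folklore] -/
theorem summable_p_low (hU : D.IsUnitary) (hconv : D.OpeConvergent) (H : ℝ) :
    Summable fun i => if D.Δ i ≤ H then D.p i else 0 := by
  have hhalf : (1 / 2 : ℝ) ∈ Ioo (0 : ℝ) 1 := ⟨by norm_num, by norm_num⟩
  have hS := hconv (1 / 2) (1 / 2) hhalf hhalf
  have hc0 : 0 < 2 * (1 / 2 : ℝ) ^ H := by positivity
  refine (hS.mul_left (2 * (1 / 2 : ℝ) ^ H)⁻¹).of_nonneg_of_le (fun i => ?_) fun i => ?_
  · by_cases h : D.Δ i ≤ H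
    · simp only [h, if_true]; exact (hU i).2.2
    · simp [h]
  · by_cases h : D.Δ i ≤ H
    · simp only [h, if_true]
      have hg : 2 * (1 / 2 : ℝ) ^ H ≤ globalBlock (D.Δ i) (D.spin i) (1 / 2) (1 / 2) := by
        have h1 := two_mul_rpow_le_globalBlock_diag (hU i).2.1 (x := 1 / 2) (by norm_num) (by norm_num)
        have h2 : (1 / 2 : ℝ) ^ H ≤ (1 / 2 : ℝ) ^ D.Δ i :=
          Real.rpow_le_rpow_of_exponent_ge (by norm_num) (by norm_num) h
        linarith
      have hp0 : 0 ≤ D.p i := (hU i).2.2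
      calc D.p i = (2 * (1 / 2 : ℝ) ^ H)⁻¹ * (D.p i * (2 * (1 / 2 : ℝ) ^ H)) := by field_simp
        _ ≤ (2 * (1 / 2 : ℝ) ^ H)⁻¹ * (D.p i * globalBlock (D.Δ i) (D.spin i) (1 / 2) (1 / 2)) :=
            mul_le_mul_of_nonneg_left (mul_le_mul_of_nonneg_left hg hp0) (inv_nonneg.mpr hc0.le)
    · simp only [h, if_false]
      exact mul_nonneg (inv_nonneg.mpr hc0.le)
        (mul_nonneg (hU i).2.2 (globalBlock_nonneg (hU i).2.1 hhalf hhalf))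

/-- **The split estimate at `z̄₁ = 1/4` against `z̄₂ = 1/2` under bounded spin.** If every label with `p_i ≠ 0` has spin
`≤ L` and `K` is an envelope constant for `[0,H]`, then for `1/2 ≤ z < 1`:
`G(z,1/4) - 1 ≤ 2(K/(1-z)^ε)² · Q + (1/2)^{(H-L)/2} · (G(z,1/2) - 1)`, `Q = Σ_{Δ_i ≤ H} p_i`. [folklore] -/
theorem fourPoint_quarter_le_of_spin_le (hU : D.IsUnitary) (hconv : D.OpeConvergent) {L : ℕ} {H ε K : ℝ}
    (hB : ∀ i, D.p i ≠ 0 → D.spin i ≤ L)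
    (hK : ∀ (Δ : ℝ) (ℓ : ℕ), (ℓ : ℝ) ≤ Δ → Δ ≤ H → ∀ x : ℝ, 0 < x → x < 1 →
      globalBlock Δ ℓ x x ≤ 2 * (K / (1 - x) ^ ε) ^ 2)
    {z : ℝ} (hz2 : 1 / 2 ≤ z) (hz1 : z < 1) :
    D.fourPoint z (1 / 4) - 1 ≤ 2 * (K / (1 - z) ^ ε) ^ 2 * (∑' i, if D.Δ i ≤ H then D.p i else 0) +
      (1 / 2 : ℝ) ^ ((H - L) / 2) * (D.fourPoint z (1 / 2) - 1) := by
  have hz : z ∈ Ioo (0 : ℝ) 1 := ⟨by linarith, hz1⟩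
  have hq : (1 / 4 : ℝ) ∈ Ioo (0 : ℝ) 1 := ⟨by norm_num, by norm_num⟩
  have hh : (1 / 2 : ℝ) ∈ Ioo (0 : ℝ) 1 := ⟨by norm_num, by norm_num⟩
  have hQ := summable_p_low hU hconv H
  have hθ0 : (0 : ℝ) < 1 / 2 := by norm_num
  -- termwise: `p_i g_i(z,1/4) ≤ 2B² q_i + θ^{(H-L)/2} p_i g_i(z,1/2)`
  have hle : ∀ i, D.p i * globalBlock (D.Δ i) (D.spin i) z (1 / 4) ≤
      2 * (K / (1 - z) ^ ε) ^ 2 * (if D.Δ i ≤ H then D.p i else 0) +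
        (1 / 2 : ℝ) ^ ((H - L) / 2) * (D.p i * globalBlock (D.Δ i) (D.spin i) z (1 / 2)) := by
    intro i
    have hp0 : 0 ≤ D.p i := (hU i).2.2
    have hg2 : 0 ≤ globalBlock (D.Δ i) (D.spin i) z (1 / 2) := globalBlock_nonneg (hU i).2.1 hz hh
    have hB2 : 0 ≤ 2 * (K / (1 - z) ^ ε) ^ 2 := by positivity
    by_cases hp : D.p i = 0
    · simp [hp]
    by_cases hlow : D.Δ i ≤ H
    · -- low dimension: `g(z,1/4) ≤ g(z,z) ≤ 2B²`
      simp only [hlow, if_true]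
      have h1 : globalBlock (D.Δ i) (D.spin i) z (1 / 4) ≤ globalBlock (D.Δ i) (D.spin i) z z :=
        globalBlock_mono (hU i).2.1 hz.1 (by norm_num) le_rfl (by linarith) hz1 hz1
      have h2 := hK _ _ (hU i).2.1 hlow z hz.1 hz1
      have h3 : 0 ≤ (1 / 2 : ℝ) ^ ((H - L) / 2) * (D.p i * globalBlock (D.Δ i) (D.spin i) z (1 / 2)) :=
        mul_nonneg (Real.rpow_nonneg hθ0.le _) (mul_nonneg hp0 hg2)
      nlinarith [mul_le_mul_of_nonneg_left (h1.trans h2) hp0]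
    · -- high dimension, spin `≤ L`: suppression by `(1/2)^{(Δ-ℓ)/2} ≤ (1/2)^{(H-L)/2}`
      simp only [hlow, if_false, mul_zero, zero_add]
      have hℓ : (D.spin i : ℝ) ≤ L := by exact_mod_cast hB i hp
      have hΔ : H < D.Δ i := lt_of_not_ge hlow
      have h1 := globalBlock_le_rpow_mul (hU i).2.1 hz (by norm_num : (0 : ℝ) < 1 / 4)
        (by norm_num : (1 / 4 : ℝ) ≤ 1 / 2) (by norm_num : (1 / 2 : ℝ) < 1)
      rw [show ((1 / 4 : ℝ) / (1 / 2)) = 1 / 2 by norm_num] at h1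
      have h2 : (1 / 2 : ℝ) ^ ((D.Δ i - D.spin i) / 2) ≤ (1 / 2 : ℝ) ^ ((H - L) / 2) :=
        Real.rpow_le_rpow_of_exponent_ge hθ0 (by norm_num) (by linarith)
      calc D.p i * globalBlock (D.Δ i) (D.spin i) z (1 / 4)
          ≤ D.p i * ((1 / 2 : ℝ) ^ ((D.Δ i - D.spin i) / 2) * globalBlock (D.Δ i) (D.spin i) z (1 / 2)) :=
            mul_le_mul_of_nonneg_left h1 hp0
        _ ≤ D.p i * ((1 / 2 : ℝ) ^ ((H - L) / 2) * globalBlock (D.Δ i) (D.spin i) z (1 / 2)) :=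
            mul_le_mul_of_nonneg_left (mul_le_mul_of_nonneg_right h2 hg2) hp0
        _ = (1 / 2 : ℝ) ^ ((H - L) / 2) * (D.p i * globalBlock (D.Δ i) (D.spin i) z (1 / 2)) := by ring
  have h := hasSum_le hle (hconv z (1 / 4) hz hq).hasSum ((hQ.hasSum.mul_left (2 * (K / (1 - z) ^ ε) ^ 2)).add
    ((hconv z (1 / 2) hz hh).hasSum.mul_left ((1 / 2 : ℝ) ^ ((H - L) / 2))))
  have e1 : D.fourPoint z (1 / 4) - 1 = ∑' i, D.p i * globalBlock (D.Δ i) (D.spin i) z (1 / 4) := by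
    unfold fourPoint; ring
  have e2 : D.fourPoint z (1 / 2) - 1 = ∑' i, D.p i * globalBlock (D.Δ i) (D.spin i) z (1 / 2) := by
    unfold fourPoint; ring
  rw [e1, e2]
  exact h

/-- **No bounded spin (crossing forces quasi-primaries of arbitrarily large spin).** A unitary solution of the typed
`⟨σσσσ⟩` sum rule at `Δ_σ = s > 0` whose `s`-channel expansion converges on the open square has, above EVERY `L`, a label
with non-zero squared OPE coefficient and spin `> L`. [folklore] -/
theorem exists_spin_gt (hU : D.IsUnitary) (hC : D.SatisfiesCrossing s) (hs : 0 < s) (hconv : D.OpeConvergent)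
    (L : ℕ) : ∃ i, D.p i ≠ 0 ∧ L < D.spin i := by
  by_contra hneg
  push Not at hneg
  -- hneg : ∀ i, D.p i ≠ 0 → D.spin i ≤ L
  set c₀ : ℝ := D.fourPoint (1 / 2) (1 / 2) with hc₀
  have hhalf : (1 / 2 : ℝ) ∈ Ioo (0 : ℝ) 1 := ⟨by norm_num, by norm_num⟩
  have hc₀1 : 1 ≤ c₀ := one_le_fourPoint hU hhalf hhalf
  set q : ℝ := (1 / 6 : ℝ) ^ s with hqdef
  have hq0 : 0 < q := by positivity
  -- choose `N` with `(1/2)^N · c₀ ≤ q/4`, then `H = L + 2N`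
  obtain ⟨N, hN⟩ : ∃ N : ℕ, 4 * c₀ / q < (2 : ℝ) ^ N := pow_unbounded_of_one_lt _ (by norm_num)
  have hθN : (1 / 2 : ℝ) ^ (N : ℝ) * c₀ ≤ q / 4 := by
    rw [Real.rpow_natCast, one_div_pow]
    have h2N : 0 < (2 : ℝ) ^ N := by positivity
    rw [div_lt_iff₀ hq0] at hN
    rw [one_div, inv_mul_le_iff₀ h2N]
    linarith
  set H : ℝ := (L : ℝ) + 2 * N with hHdef
  have hHL : (H - L) / 2 = N := by rw [hHdef]; ring
  have hε : 0 < s / 4 := by linarith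
  obtain ⟨K, hK0, hK⟩ := exists_globalBlock_diag_le_envelope H hε
  have hQ := summable_p_low hU hconv H
  set Q : ℝ := ∑' i, (if D.Δ i ≤ H then D.p i else 0) with hQdef
  have hQ0 : 0 ≤ Q := tsum_nonneg fun i => by
    by_cases h : D.Δ i ≤ H
    · simp only [h, if_true]; exact (hU i).2.2
    · simp [h]
  set M : ℝ := 2 * K ^ 2 * Q + 1 with hMdef
  have hM0 : 0 < M := by positivity
  -- the point `z = 1 - t`
  set t : ℝ := min (1 / 2) ((q / (2 * M)) ^ (2 / s)) with htdef
  have ht0 : 0 < t := lt_min (by norm_num) (Real.rpow_pos_of_pos (by positivity) _)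
  have ht2 : t ≤ 1 / 2 := min_le_left _ _
  have hts2 : t ^ (s / 2) ≤ q / (2 * M) := by
    have h1 : t ^ (s / 2) ≤ ((q / (2 * M)) ^ (2 / s)) ^ (s / 2) :=
      Real.rpow_le_rpow ht0.le (min_le_right _ _) (by linarith)
    rw [← Real.rpow_mul (by positivity), show 2 / s * (s / 2) = 1 by field_simp, Real.rpow_one] at h1
    exact h1
  have hts0 : 0 < t ^ (s / 2) := Real.rpow_pos_of_pos ht0 _
  have hts1 : t ^ (s / 2) ≤ 1 := Real.rpow_le_one ht0.le (by linarith) (by linarith)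
  have hz2 : 1 / 2 ≤ 1 - t := by linarith
  have hz1 : 1 - t < 1 := by linarith
  have hz : (1 - t) ∈ Ioo (0 : ℝ) 1 := ⟨by linarith, hz1⟩
  -- the three estimates at `z = 1 - t`
  have hlow := fourPoint_lightcone_lower hU hC hconv hz
  have hup := fourPoint_lightcone_upper hU hC hs.le hconv hz2 hz1
  have hsplit := fourPoint_quarter_le_of_spin_le hU hconv hneg hK hz2 hz1
  rw [← hQdef, hHL] at hsplit
  rw [sub_sub_cancel] at hlow hup hsplit
  rw [← hc₀] at hup
  -- rewrite the powers of `t`: `t^s = (t^{s/2})²`, `(K/t^{s/4})² = K²/t^{s/2}`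
  have hts : t ^ s = t ^ (s / 2) * t ^ (s / 2) := by
    rw [← Real.rpow_add ht0]; ring_nf
  have hKt : (K / t ^ (s / 4)) ^ 2 = K ^ 2 / t ^ (s / 2) := by
    rw [div_pow, ← Real.rpow_natCast (t ^ (s / 4)) 2, ← Real.rpow_mul ht0.le]
    rw [show s / 4 * ((2 : ℕ) : ℝ) = s / 2 by push_cast; ring]
  rw [hKt] at hsplit
  have hzs : q ≤ ((1 - t) / 3) ^ s := by
    rw [hqdef]
    exact Real.rpow_le_rpow (by norm_num) (by linarith) hs.le
  -- `G(z,1/2) - 1 ≤ G(z,1/2) ≤ c₀ / t^s`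
  have hG2 : D.fourPoint (1 - t) (1 / 2) - 1 ≤ c₀ / t ^ s := by
    have htspos : 0 < t ^ s := Real.rpow_pos_of_pos ht0 s
    rw [le_div_iff₀ htspos]
    nlinarith [hup, htspos]
  -- combine: `q ≤ t^s · G(z,1/4) ≤ t^s (1 + 2K²Q/t^{s/2} + (1/2)^N (c₀/t^s))`
  have hθ0 : 0 ≤ (1 / 2 : ℝ) ^ (N : ℝ) := Real.rpow_nonneg (by norm_num) _
  have hA : t ^ s * D.fourPoint (1 - t) (1 / 4) ≤
      t ^ s * (1 + 2 * (K ^ 2 / t ^ (s / 2)) * Q + (1 / 2 : ℝ) ^ (N : ℝ) * (c₀ / t ^ s)) := by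
    apply mul_le_mul_of_nonneg_left _ (Real.rpow_nonneg ht0.le s)
    have := mul_le_mul_of_nonneg_left hG2 hθ0
    linarith
  have hB : t ^ s * (1 + 2 * (K ^ 2 / t ^ (s / 2)) * Q + (1 / 2 : ℝ) ^ (N : ℝ) * (c₀ / t ^ s)) =
      t ^ (s / 2) * (t ^ (s / 2) + 2 * K ^ 2 * Q) + (1 / 2 : ℝ) ^ (N : ℝ) * c₀ := by
    rw [hts]
    field_simp
  have hCc : t ^ (s / 2) * (t ^ (s / 2) + 2 * K ^ 2 * Q) ≤ t ^ (s / 2) * M := by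
    apply mul_le_mul_of_nonneg_left _ hts0.le
    rw [hMdef]; linarith
  have hDd : t ^ (s / 2) * M ≤ q / (2 * M) * M := mul_le_mul_of_nonneg_right hts2 hM0.le
  have hEe : q / (2 * M) * M = q / 2 := by field_simp
  -- `q ≤ t^s G(z,1/4) ≤ q/2 + q/4`
  have hchain : q ≤ t ^ (s / 2) * (t ^ (s / 2) + 2 * K ^ 2 * Q) + (1 / 2 : ℝ) ^ (N : ℝ) * c₀ := by
    rw [← hB]; exact hzs.trans (hlow.trans hA)
  linarith

/-- **Infinitely many labels of spin above every bound** (a finite set has a largest spin; apply `exists_spin_gt` above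
it). [folklore] -/
theorem infinite_spin_above (hU : D.IsUnitary) (hC : D.SatisfiesCrossing s) (hs : 0 < s) (hconv : D.OpeConvergent)
    (L : ℕ) : {i | D.p i ≠ 0 ∧ L < D.spin i}.Infinite := by
  intro hfin
  obtain ⟨B, hB⟩ := (hfin.image D.spin).bddAbove
  obtain ⟨i, hp, hL⟩ := exists_spin_gt hU hC hs hconv (max L B)
  have hi : i ∈ {i | D.p i ≠ 0 ∧ L < D.spin i} := ⟨hp, lt_of_le_of_lt (le_max_left _ _) hL⟩
  have hle : D.spin i ≤ B := hB (Set.mem_image_of_mem D.spin hi)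
  have := le_max_right L B
  omega

/-- **Infinitely many SPINNING quasi-primaries** (`ℓ ≠ 0`, `p ≠ 0`) in every unitary typed solution at `Δ_σ > 0` with
convergent expansion — a tower of scalars alone is never crossing symmetric. [folklore] -/
theorem infinite_spinning (hU : D.IsUnitary) (hC : D.SatisfiesCrossing s) (hs : 0 < s) (hconv : D.OpeConvergent) :
    {i | D.p i ≠ 0 ∧ D.spin i ≠ 0}.Infinite :=
  (infinite_spin_above hU hC hs hconv 0).mono fun _ hi => ⟨hi.1, Nat.pos_iff_ne_zero.mp hi.2⟩

/-- Under a uniform lower bound `Δ_i ≥ τ₀ > 2s` (`0 < s`) the convergence clause is a theorem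
(`opeConvergent_of_lowerBound`): non-zero OPE coefficients at arbitrarily large spin. [folklore] -/
theorem infinite_spin_above_of_lowerBound (hU : D.IsUnitary) (hC : D.SatisfiesCrossing s) (hs : 0 < s) {τ₀ : ℝ}
    (hτ : ∀ i, τ₀ ≤ D.Δ i) (hτ₀ : 2 * s < τ₀) (L : ℕ) : {i | D.p i ≠ 0 ∧ L < D.spin i}.Infinite :=
  infinite_spin_above hU hC hs (opeConvergent_of_lowerBound hU hC hτ hτ₀) L

/-- In the branch of a gap statement (`HasScalarGap U`, `U > 2s`, `0 < s < 1`): non-zero OPE coefficients at arbitrarily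
large spin. [folklore] -/
theorem infinite_spin_above_of_hasScalarGap (hU : D.IsUnitary) (hC : D.SatisfiesCrossing s) (hs : 0 < s) {U : ℝ}
    (hgap : D.HasScalarGap U) (hU2 : 2 * s < U) (hs1 : s < 1) (L : ℕ) :
    {i | D.p i ≠ 0 ∧ L < D.spin i}.Infinite :=
  infinite_spin_above hU hC hs (opeConvergent_of_hasScalarGap hU hC hgap hU2 hs1) L

/-- In the branch of a single-location statement (scalars in `{x₀} ∪ [G,∞)`, `x₀, G > 2s`, `0 < s < 1`): non-zero OPE
coefficients at arbitrarily large spin. [folklore] -/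
theorem infinite_spin_above_of_location (hU : D.IsUnitary) (hC : D.SatisfiesCrossing s) (hs : 0 < s) {x₀ G : ℝ}
    (hS : D.ScalarsIn ({x₀} ∪ Ici G)) (hx : 2 * s < x₀) (hG : 2 * s < G) (hs1 : s < 1) (L : ℕ) :
    {i | D.p i ≠ 0 ∧ L < D.spin i}.Infinite :=
  infinite_spin_above hU hC hs (opeConvergent_of_location hU hC hS hx hG hs1) L

end CrossingData

/-! ### The record's class at `Δ_σ = 1/8` and the two witnesses -/

/-- **Every typed `A2D′` datum of the record's class at `Δ_σ = 1/8` has `σ × σ` quasi-primaries of arbitrarily large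
spin with non-zero OPE coefficient** (convergence from `record_fourPoint_crossing`, `x > 0.99`). CONTROL-ONLY; a
statement about the control's typed class, not about any CFT; no number of the record is touched. [folklore] -/
theorem record_unbounded_spin (w : ℝ) (D : CrossingData) (hU : D.IsUnitary)
    (hC : D.SatisfiesCrossing (1 / 8)) (hT : D.SpinTwoIn ({2} ∪ Ici (2 + 1))) (x : ℝ) (hwx : w ≤ x)
    (hS : D.ScalarsIn ({x} ∪ Ici 2)) (L : ℕ) : {i | D.p i ≠ 0 ∧ L < D.spin i}.Infinite :=
  CrossingData.infinite_spin_above hU hC (by norm_num) (record_fourPoint_crossing w D hU hC hT x hwx hS).1 L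

/-- The 2D Ising datum of E.1e has non-zero OPE coefficients at arbitrarily large spin (from crossing alone).
[folklore] -/
theorem isingData2D_unbounded_spin (L : ℕ) : {i | isingData2D.p i ≠ 0 ∧ L < isingData2D.spin i}.Infinite :=
  CrossingData.infinite_spin_above isingData2D_isUnitary isingData2D_satisfiesCrossing (by norm_num)
    isingData2D_opeConvergent L

/-- The generalised-free witness of E.1c at any `s > 0` has non-zero OPE coefficients at arbitrarily large spin.
[folklore] -/
theorem gffData2D_unbounded_spin {s : ℝ} (hs : 0 < s) (L : ℕ) :
    {i | (gffData2D s).p i ≠ 0 ∧ L < (gffData2D s).spin i}.Infinite :=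
  CrossingData.infinite_spin_above (gffData2D_isUnitary hs) (gffData2D_satisfiesCrossing hs) hs
    (gffData2D_opeConvergent hs) L

end Summit.CriticalPhenomena.Ising3D.Control2D
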